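import Summits.ResolutionOfSingularities.ResolutionOfSingularities.Theorems.FrobeniusLadderFInjectiveMacaulayficationE8OffCentreRegularChar3
import Summits.ResolutionOfSingularities.ResolutionOfSingularities.Theorems.FrobeniusLadderFInjectiveMacaulayficationFiClauseOfRegular
import Summits.ResolutionOfSingularities.ResolutionOfSingularities.Theorems.FrobeniusLadderFInjectiveMacaulayficationDegreeZeroDescent
import Mathlib.RingTheory.MvPolynomial.WeightedHomogeneous
import Mathlib.Algebra.MvPolynomial.PDeriv
import Mathlib.Algebra.CharP.Lemmas
import HarnessLib

/-!
# `E₈⁰` as a WEIGHTED-homogeneous isolated point: the data every weighted-blow-up engine consumes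
# (crux `FInjectiveMacaulayfication`, line `Sketch`, §15/§16)

Support file for crux stmt-ResolutionOfSingularities-15315 (`FrobeniusLadder.FInjectiveMacaulayfication`), chain w45a,
lead seat res-L1-w45a-lead-1. The surface singularity `E₈⁰ : f = X₂² + X₀³ + X₁⁵` is the line's standing calibration
specimen (`E8Char5FiModel` p139106: one point blow-up in char `5`; `E8Char3TowerFiModel` p156147: a tower of two in char
`3`; survey j023222: four point blow-ups in char `2`). For the WEIGHTED blow-up (weights `w = (10, 6, 15)` on
`X₀, X₁, X₂`, `N = 30`, cover exponents `c = (3, 5, 2)`) the engines of §15 (`WeightedConeCore.weightedConeFiModel_of_chartClause`,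
p460946) and of the proposed §16 (graded engine) need exactly three specimen-specific inputs, provided here for EVERY
characteristic at once:

* `e8_isWeightedHomogeneous` — `f` is weighted-homogeneous of weight `30`;
* `e8VeroneseSplitting` — VERONESE SATURATION for `(10,6,15)`, `N = 30`: a monomial of weighted degree `≥ 30K` lies in
  `I₃₀^K` (peel `X₀³`, `X₁⁵` or `X₂²` of weight exactly `30`; otherwise the exponent vector lies in the box
  `a₀ ≤ 2, a₁ ≤ 4, a₂ ≤ 1` of weight `≤ 59 < 60`, so `K ≤ 1` and there is nothing to split — contrast `f₄`'s `(6,3,9,2)`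
  (`VeroneseSplitting`, p173737) where a finite check was needed, and BP(2,3,7)'s `(21,14,6)`, `N = 42`, where saturation FAILS);
* `e8OffCentreRegularChar2` — `E₈⁰` is regular off the origin in characteristic `2` as well (`∂₀f = 3X₀²`, `∂₁f = 5X₁⁴` with
  `3, 5` units; if `X₀, X₁ ∈ P` then `X₂² = f − X₀³ − X₁⁵ ∈ P`), complementing `E8OffCentreRegular` (p138059, char `5`) and
  `E8OffCentreRegularChar3` (p145223); and the conversion `offOrigin_clause_of_regular` of off-centre REGULARITY into the
  off-origin CLAUSE hypothesis `hoff` of the engines (maximal `Q` missing some `x̄ⱼ` ⇒ per-stalk clause), instantiated as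
  `e8_offOrigin_clause_char2/3/5`.

All proofs are glue on Mathlib and landed files; no definitions, no named facts. [folklore]
-/

set_option linter.dupNamespace false

noncomputable section

namespace Summit.ResolutionOfSingularities.ResolutionOfSingularities.Theorems.FInjectiveMacaulayfication.E8WeightedData

open MvPolynomial

/-! ## Weighted homogeneity -/

/-- The `(10,6,15)`-weighted degree of an exponent vector `a : Fin 3 →₀ ℕ` in coordinates:
`weight ![10,6,15] a = 10 a₀ + 6 a₁ + 15 a₂`. [folklore] -/
theorem weight_eq (a : Fin 3 →₀ ℕ) :
    Finsupp.weight (![10, 6, 15] : Fin 3 → ℕ) a = 10 * a 0 + 6 * a 1 + 15 * a 2 := by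
  rw [Finsupp.weight_apply,
    Finsupp.sum_fintype a (fun i c => c • (![10, 6, 15] : Fin 3 → ℕ) i) (fun _ => zero_smul ℕ _),
    Fin.sum_univ_three]
  simp only [smul_eq_mul, Matrix.cons_val_zero, Matrix.cons_val_one, Matrix.cons_val]
  ring

/-- **`E₈⁰` is weighted-homogeneous of weight `30` for the weights `(10,6,15)`** (`X₂²`, `X₀³`, `X₁⁵` all have weight `30`).
[folklore] -/
theorem e8_isWeightedHomogeneous (k : Type) [Field k] :
    MvPolynomial.IsWeightedHomogeneous (![10, 6, 15] : Fin 3 → ℕ)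
      (X 2 ^ 2 + X 0 ^ 3 + X 1 ^ 5 : MvPolynomial (Fin 3) k) 30 := by
  refine ((?_ : IsWeightedHomogeneous _ _ 30).add ?_).add ?_
  · simpa using (isWeightedHomogeneous_X k (![10, 6, 15] : Fin 3 → ℕ) 2).pow 2
  · simpa using (isWeightedHomogeneous_X k (![10, 6, 15] : Fin 3 → ℕ) 0).pow 3
  · simpa using (isWeightedHomogeneous_X k (![10, 6, 15] : Fin 3 → ℕ) 1).pow 5

/-! ## Veronese saturation for `(10,6,15)`, `N = 30` -/

/-- **Coordinate splitting**: if `(K+1)·30 ≤ 10a₀ + 6a₁ + 15a₂` then `a = b + c` with `30 ≤ 10b₀+6b₁+15b₂` and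
`K·30 ≤ 10c₀+6c₁+15c₂` — peel `X₀³`, `X₁⁵` or `X₂²` (weight exactly `30`); otherwise the box `a₀ ≤ 2, a₁ ≤ 4, a₂ ≤ 1` has weight
`≤ 59`, forcing `K = 0`. [folklore] -/
theorem coord_split (K a₀ a₁ a₂ : ℕ) (h : (K + 1) * 30 ≤ 10 * a₀ + 6 * a₁ + 15 * a₂) :
    ∃ b₀ b₁ b₂ c₀ c₁ c₂ : ℕ, a₀ = b₀ + c₀ ∧ a₁ = b₁ + c₁ ∧ a₂ = b₂ + c₂ ∧
      30 ≤ 10 * b₀ + 6 * b₁ + 15 * b₂ ∧ K * 30 ≤ 10 * c₀ + 6 * c₁ + 15 * c₂ := by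
  by_cases h₀ : 3 ≤ a₀
  · exact ⟨3, 0, 0, a₀ - 3, a₁, a₂, by omega⟩
  by_cases h₁ : 5 ≤ a₁
  · exact ⟨0, 5, 0, a₀, a₁ - 5, a₂, by omega⟩
  by_cases h₂ : 2 ≤ a₂
  · exact ⟨0, 0, 2, a₀, a₁, a₂ - 2, by omega⟩
  -- the box: weight `≤ 20 + 24 + 15 = 59 < 60`, hence `K = 0`
  rcases Nat.eq_zero_or_pos K with rfl | hK
  · exact ⟨a₀, a₁, a₂, 0, 0, 0, by omega⟩
  · exfalso
    have : 2 * 30 ≤ (K + 1) * 30 := Nat.mul_le_mul_right _ (by omega)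
    omega

/-- **Exponent-vector splitting** (`coord_split` along `Finsupp.equivFunOnFinite`). [folklore] -/
theorem finsupp_split (K : ℕ) (a : Fin 3 →₀ ℕ)
    (ha : (K + 1) * 30 ≤ Finsupp.weight (![10, 6, 15] : Fin 3 → ℕ) a) :
    ∃ b c : Fin 3 →₀ ℕ, a = b + c ∧ 30 ≤ Finsupp.weight (![10, 6, 15] : Fin 3 → ℕ) b ∧
      K * 30 ≤ Finsupp.weight (![10, 6, 15] : Fin 3 → ℕ) c := by
  rw [weight_eq] at ha
  obtain ⟨b₀, b₁, b₂, c₀, c₁, c₂, e₀, e₁, e₂, hb, hc⟩ := coord_split K (a 0) (a 1) (a 2) ha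
  refine ⟨Finsupp.equivFunOnFinite.symm ![b₀, b₁, b₂], Finsupp.equivFunOnFinite.symm ![c₀, c₁, c₂], ?_, ?_, ?_⟩
  · ext i
    fin_cases i <;> simp [e₀, e₁, e₂]
  · rw [weight_eq]
    simpa using hb
  · rw [weight_eq]
    simpa using hc

/-- **VERONESE SATURATION for the weights `(10,6,15)` and `N = 30`** (the `hpow` hypothesis of the weighted-blow-up engines
for `E₈⁰`): every monomial of weighted degree `≥ 30K` lies in `I₃₀^K`. [folklore] -/
theorem e8VeroneseSplitting : ∀ (k : Type) [Field k] (K : ℕ) (a : Fin 3 →₀ ℕ),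
    K * 30 ≤ Finsupp.weight (![10, 6, 15] : Fin 3 → ℕ) a →
    (MvPolynomial.monomial a (1 : k) : MvPolynomial (Fin 3) k) ∈
      (Ideal.span {m : MvPolynomial (Fin 3) k | ∃ b : Fin 3 →₀ ℕ,
        30 ≤ Finsupp.weight (![10, 6, 15] : Fin 3 → ℕ) b ∧ m = MvPolynomial.monomial b 1}) ^ K := by
  intro k _ K
  induction K with
  | zero =>
    intro a _
    rw [pow_zero, Ideal.one_eq_top]
    exact Submodule.mem_top
  | succ K ih =>
    intro a ha
    obtain ⟨b, c, rfl, hb, hc⟩ := finsupp_split K a ha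
    have hmul : (MvPolynomial.monomial (b + c) (1 : k) : MvPolynomial (Fin 3) k) =
        MvPolynomial.monomial b 1 * MvPolynomial.monomial c 1 := by
      rw [MvPolynomial.monomial_mul, one_mul]
    rw [pow_succ', hmul]
    exact Ideal.mul_mem_mul (Ideal.subset_span ⟨b, hb, rfl⟩) (ih c hc)

/-! ## Regularity off the origin in characteristic `2`, and the off-origin clause at every `p ∈ {2,3,5}` -/

/-- `3 ≠ 0` in characteristic `2`. [folklore] -/
theorem three_ne_zero_of_charP_two {k : Type*} [Field k] [CharP k 2] : (3 : k) ≠ 0 := by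
  intro h
  have h' : ((3 : ℕ) : k) = 0 := by exact_mod_cast h
  rw [CharP.cast_eq_zero_iff k 2 3] at h'
  omega

/-- `5 ≠ 0` in characteristic `2`. [folklore] -/
theorem five_ne_zero_of_charP_two {k : Type*} [Field k] [CharP k 2] : (5 : k) ≠ 0 := by
  intro h
  have h' : ((5 : ℕ) : k) = 0 := by exact_mod_cast h
  rw [CharP.cast_eq_zero_iff k 2 5] at h'
  omega

/-- **`E₈⁰` in characteristic `2` is regular off the origin**: for `f = X₂² + X₀³ + X₁⁵` over a field of characteristic `2`
and a prime `P` of `R = k[X]/(f)` not containing `𝔪 = (x̄₀, x̄₁, x̄₂)`, `R_P` is regular — Jacobian criterion with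
`∂₀f = 3X₀²` (if `X₀ ∉ P`) or `∂₁f = 5X₁⁴` (if `X₁ ∉ P`); if `X₀, X₁ ∈ P` then `X₂² = f − X₀³ − X₁⁵ ∈ P` and `𝔪 ≤ P`.
[cite: Matsumura1987, Thm. 30.4 (ii)] -/
theorem e8OffCentreRegularChar2 : ∀ (k : Type) [Field k] [CharP k 2] (f : MvPolynomial (Fin 3) k),
    f = MvPolynomial.X 2 ^ 2 + MvPolynomial.X 0 ^ 3 + MvPolynomial.X 1 ^ 5 →
    ∀ (P : Ideal (MvPolynomial (Fin 3) k ⧸ Ideal.span {f})) [P.IsPrime],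
      ¬ Ideal.span (Set.range fun j : Fin 3 => Ideal.Quotient.mk (Ideal.span {f}) (MvPolynomial.X j)) ≤ P →
      IsRegularLocalRing (Localization.AtPrime P) := by
  intro k _ _ f hf P _ hP
  haveI hprime : (P.comap (Ideal.Quotient.mk (Ideal.span {f}))).IsPrime := Ideal.comap_isPrime _ _
  have hfP : f ∈ P.comap (Ideal.Quotient.mk (Ideal.span {f})) := by
    rw [Ideal.mem_comap, Ideal.Quotient.eq_zero_iff_mem.mpr (Ideal.mem_span_singleton_self f)]
    exact P.zero_mem
  by_cases h0 : (X 0 : MvPolynomial (Fin 3) k) ∈ P.comap (Ideal.Quotient.mk (Ideal.span {f}))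
  · by_cases h1 : (X 1 : MvPolynomial (Fin 3) k) ∈ P.comap (Ideal.Quotient.mk (Ideal.span {f}))
    · -- `X₀, X₁ ∈ P₀`: then `X₂ ∈ P₀` too, so `𝔪 ≤ P`, excluded
      exfalso
      refine hP ?_
      have h2 : (X 2 : MvPolynomial (Fin 3) k) ∈ P.comap (Ideal.Quotient.mk (Ideal.span {f})) := by
        refine hprime.mem_of_pow_mem 2 ?_
        have e : (X 2 ^ 2 : MvPolynomial (Fin 3) k) = f - X 0 ^ 3 - X 1 ^ 5 := by
          rw [hf]; ring
        rw [e]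
        exact Ideal.sub_mem _ (Ideal.sub_mem _ hfP (Ideal.pow_mem_of_mem _ h0 3 (by norm_num)))
          (Ideal.pow_mem_of_mem _ h1 5 (by norm_num))
      rw [Ideal.span_le, Set.range_subset_iff]
      intro j
      fin_cases j
      exacts [h0, h1, h2]
    · -- `X₀ ∈ P₀`, `X₁ ∉ P₀`: Jacobian criterion with `∂f/∂X₁ = 5X₁⁴ ∉ P₀`
      refine HypersurfaceRegular.stub_hypersurfaceRegularOfPderiv k 3 f 1 P (fun hd => h1 ?_)
      have e : pderiv 1 f = C 5 * X 1 ^ 4 := by rw [hf]; exact E8OffCentreRegularChar3.pderiv_one_e8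
      rw [e] at hd
      exact hprime.mem_of_pow_mem 4 (E8OffCentreRegular.mem_of_C_mul_mem _ five_ne_zero_of_charP_two hd)
  · -- `X₀ ∉ P₀`: Jacobian criterion with `∂f/∂X₀ = 3X₀² ∉ P₀`
    refine HypersurfaceRegular.stub_hypersurfaceRegularOfPderiv k 3 f 0 P (fun hd => h0 ?_)
    have e : pderiv 0 f = C 3 * X 0 ^ 2 := by rw [hf]; exact E8OffCentreRegular.pderiv_zero_e8
    rw [e] at hd
    exact hprime.mem_of_pow_mem 2 (E8OffCentreRegular.mem_of_C_mul_mem _ three_ne_zero_of_charP_two hd)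

/-- **Off-centre regularity ⇒ the engines' off-origin clause hypothesis**: if `R = k[X]/(f)` (characteristic `p`) is regular at
every prime not containing `𝔪 = (x̄ⱼ)`, then at every maximal ideal `Q` missing some `x̄ⱼ` the local ring `R_Q` satisfies the
per-stalk clause of the crux (regular ⇒ every s.o.p. weakly regular and every parameter ideal Frobenius closed,
`FiClauseOfRegular.stub_fiClauseOfRegular`). This is the shape `hoff` of `WeightedConeCore.weightedConeFiModel_of_chartClause`.
[folklore] -/
theorem offOrigin_clause_of_regular (p : ℕ) [Fact p.Prime] (k : Type) [Field k] [CharP k p] {n : ℕ}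
    (f : MvPolynomial (Fin n) k)
    (hreg : ∀ (P : Ideal (MvPolynomial (Fin n) k ⧸ Ideal.span {f})) [P.IsPrime],
      ¬ Ideal.span (Set.range fun j : Fin n => Ideal.Quotient.mk (Ideal.span {f}) (MvPolynomial.X j)) ≤ P →
      IsRegularLocalRing (Localization.AtPrime P)) :
    ∀ (Q : Ideal (MvPolynomial (Fin n) k ⧸ Ideal.span {f})) [Q.IsMaximal],
      (∃ j : Fin n, Ideal.Quotient.mk (Ideal.span {f}) (MvPolynomial.X j) ∉ Q) →
      ∀ d : ℕ, ringKrullDim (Localization.AtPrime Q) = d → ∀ s : Fin d → Localization.AtPrime Q,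
        (Ideal.span (Set.range s)).radical.IsMaximal →
          RingTheory.Sequence.IsWeaklyRegular (Localization.AtPrime Q) (List.ofFn s) ∧
          ∀ y : Localization.AtPrime Q, (∃ e : ℕ, y ^ p ^ e ∈ Ideal.span
            ((fun z : Localization.AtPrime Q => z ^ p ^ e) ''
              (Ideal.span (Set.range s) : Set (Localization.AtPrime Q)))) → y ∈ Ideal.span (Set.range s) := by
  intro Q _ hQ
  obtain ⟨j, hj⟩ := hQ
  have hle : ¬ Ideal.span (Set.range fun j : Fin n => Ideal.Quotient.mk (Ideal.span {f}) (MvPolynomial.X j)) ≤ Q :=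
    fun hle => hj (hle (Ideal.subset_span (Set.mem_range_self j)))
  haveI : IsRegularLocalRing (Localization.AtPrime Q) := hreg Q hle
  by_cases htriv : Nontrivial (MvPolynomial (Fin n) k ⧸ Ideal.span {f})
  · haveI := htriv
    haveI : CharP (MvPolynomial (Fin n) k ⧸ Ideal.span {f}) p :=
      charP_of_injective_algebraMap (algebraMap k (MvPolynomial (Fin n) k ⧸ Ideal.span {f})).injective p
    haveI : CharP (Localization.AtPrime Q) p := DegreeZeroDescent.charP_localization_atPrime p Q
    exact (FiClauseOfRegular.stub_fiClauseOfRegular p (Localization.AtPrime Q)).2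
  · exfalso
    rw [not_nontrivial_iff_subsingleton] at htriv
    exact Ideal.IsMaximal.ne_top ‹Q.IsMaximal› (Subsingleton.elim _ _)

/-- **`E₈⁰`, characteristic `2`: the off-origin clause** (input `hoff` of the weighted-blow-up engines). [folklore] -/
theorem e8_offOrigin_clause_char2 (k : Type) [Field k] [CharP k 2] (f : MvPolynomial (Fin 3) k)
    (hf : f = MvPolynomial.X 2 ^ 2 + MvPolynomial.X 0 ^ 3 + MvPolynomial.X 1 ^ 5) :
    ∀ (Q : Ideal (MvPolynomial (Fin 3) k ⧸ Ideal.span {f})) [Q.IsMaximal],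
      (∃ j : Fin 3, Ideal.Quotient.mk (Ideal.span {f}) (MvPolynomial.X j) ∉ Q) →
      ∀ d : ℕ, ringKrullDim (Localization.AtPrime Q) = d → ∀ s : Fin d → Localization.AtPrime Q,
        (Ideal.span (Set.range s)).radical.IsMaximal →
          RingTheory.Sequence.IsWeaklyRegular (Localization.AtPrime Q) (List.ofFn s) ∧
          ∀ y : Localization.AtPrime Q, (∃ e : ℕ, y ^ 2 ^ e ∈ Ideal.span
            ((fun z : Localization.AtPrime Q => z ^ 2 ^ e) ''
              (Ideal.span (Set.range s) : Set (Localization.AtPrime Q)))) → y ∈ Ideal.span (Set.range s) := by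
  haveI : Fact (Nat.Prime 2) := ⟨Nat.prime_two⟩
  exact offOrigin_clause_of_regular 2 k f (fun P _ hP => e8OffCentreRegularChar2 k f hf P hP)

/-- **`E₈⁰`, characteristic `3`: the off-origin clause** (from `E8OffCentreRegularChar3`, p145223). [folklore] -/
theorem e8_offOrigin_clause_char3 (k : Type) [Field k] [CharP k 3] (f : MvPolynomial (Fin 3) k)
    (hf : f = MvPolynomial.X 2 ^ 2 + MvPolynomial.X 0 ^ 3 + MvPolynomial.X 1 ^ 5) :
    ∀ (Q : Ideal (MvPolynomial (Fin 3) k ⧸ Ideal.span {f})) [Q.IsMaximal],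
      (∃ j : Fin 3, Ideal.Quotient.mk (Ideal.span {f}) (MvPolynomial.X j) ∉ Q) →
      ∀ d : ℕ, ringKrullDim (Localization.AtPrime Q) = d → ∀ s : Fin d → Localization.AtPrime Q,
        (Ideal.span (Set.range s)).radical.IsMaximal →
          RingTheory.Sequence.IsWeaklyRegular (Localization.AtPrime Q) (List.ofFn s) ∧
          ∀ y : Localization.AtPrime Q, (∃ e : ℕ, y ^ 3 ^ e ∈ Ideal.span
            ((fun z : Localization.AtPrime Q => z ^ 3 ^ e) ''
              (Ideal.span (Set.range s) : Set (Localization.AtPrime Q)))) → y ∈ Ideal.span (Set.range s) := by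
  haveI : Fact (Nat.Prime 3) := ⟨Nat.prime_three⟩
  exact offOrigin_clause_of_regular 3 k f
    (fun P _ hP => E8OffCentreRegularChar3.stub_e8OffCentreRegularChar3 k f hf P hP)

/-- **`E₈⁰`, characteristic `5`: the off-origin clause** (from `E8OffCentreRegular`, p138059). [folklore] -/
theorem e8_offOrigin_clause_char5 (k : Type) [Field k] [CharP k 5] (f : MvPolynomial (Fin 3) k)
    (hf : f = MvPolynomial.X 2 ^ 2 + MvPolynomial.X 0 ^ 3 + MvPolynomial.X 1 ^ 5) :
    ∀ (Q : Ideal (MvPolynomial (Fin 3) k ⧸ Ideal.span {f})) [Q.IsMaximal],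
      (∃ j : Fin 3, Ideal.Quotient.mk (Ideal.span {f}) (MvPolynomial.X j) ∉ Q) →
      ∀ d : ℕ, ringKrullDim (Localization.AtPrime Q) = d → ∀ s : Fin d → Localization.AtPrime Q,
        (Ideal.span (Set.range s)).radical.IsMaximal →
          RingTheory.Sequence.IsWeaklyRegular (Localization.AtPrime Q) (List.ofFn s) ∧
          ∀ y : Localization.AtPrime Q, (∃ e : ℕ, y ^ 5 ^ e ∈ Ideal.span
            ((fun z : Localization.AtPrime Q => z ^ 5 ^ e) ''
              (Ideal.span (Set.range s) : Set (Localization.AtPrime Q)))) → y ∈ Ideal.span (Set.range s) := by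
  haveI : Fact (Nat.Prime 5) := ⟨Nat.prime_five⟩
  exact offOrigin_clause_of_regular 5 k f
    (fun P _ hP => E8OffCentreRegular.stub_e8OffCentreRegular k f hf P hP)

end Summit.ResolutionOfSingularities.ResolutionOfSingularities.Theorems.FInjectiveMacaulayfication.E8WeightedData

end
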